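import Summits.AtomisticToContinuum.FouriersLaw.Theorems.EmbeddedDrudeMourreDrudeDissolutionReduction
import Summits.AtomisticToContinuum.FouriersLaw.Theorems.EmbeddedDrudeMourreMourreDissolutionFrameworkReduction
import HarnessLib

/-!
# `DrudeDissolution` REDUCED to the shared Gibbs/clustering hypothesis (H) and the kinetic Green–Kubo
# statement (`--supports` stmt-AtomisticToContinuum-12593; line `Sketch`, lead rev 4)

Sequel of `EmbeddedDrudeMourreDrudeDissolutionReduction.lean` (rev 3: `DrudeDissolution ⇐ (F) ∧ (K)`,
(F) = the zero-wavenumber framework `stub_zeroWavenumberFramework`, (K) = `stub_kineticGreenKubo`).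
Since rev 3 the sibling crux `MourreDissolution` (stmt-AtomisticToContinuum-12594, line
separable-vertex-faddeev-pair-sector) reduced ITS framework stub to one scalar hypothesis (H) =
`stub_gibbsClustering` (a shift-invariant, superstable, reflection-invariant DLR state of `pinnedChain`
at every `T > 0` in which the canonical Buttà–Marchioro flow has summable space–time clustering and
time-continuous summed autocorrelations of `j₀, h₀`), `Theorems.MourreDissolution.symmetricFramework_of_clustering`.
Here:

* `zeroWavenumberFramework_of_gibbsClustering` : (H) ⇒ (F) (forget the symmetry extras of the
  symmetric framework);
* `drudeDissolution_of_gibbsClustering_of_kineticGreenKubo` (registered sub-goal) : (H) → (K) →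
  `DrudeDissolution`.

So the target of route EmbeddedDrudeMourre is implied by the SAME infrastructure statement (H) that the
engine crux stmt-12594 registered (one Theorems file proving (H) serves both cruxes) plus the
Green–Kubo statement (K) on the kinetic corner. Both hypotheses are registered stub signatures verbatim.
-/

noncomputable section

namespace Summit.AtomisticToContinuum.FouriersLaw.Theorems.DrudeDissolution.LineSketch

/-- **(H) ⇒ (F): the zero-wavenumber framework of line `Sketch` from the Gibbs/clustering hypothesis
of line separable-vertex-faddeev-pair-sector** — project the symmetric framework assembled by
`Theorems.MourreDissolution.symmetricFramework_of_clustering` (canonical dynamics with carrier `bmGood`;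
at every `T > 0` a zero-wavenumber datum with DLR state and strongly continuous Koopman group) onto the
three clauses (F) keeps. [cite: Doyon2022, §4.3 Thm 4.11] -/
theorem zeroWavenumberFramework_of_gibbsClustering
    (hH : ∀ ω₂ lam β γ : ℝ, 0 < ω₂ → 0 < lam → 0 < β → ∀ T : ℝ, 0 < T →
      ∀ D : Literature.MathematicalPhysics.KineticTheory.HeatConduction.InfiniteChainDynamics (Literature.MathematicalPhysics.KineticTheory.HeatConduction.pinnedChain ω₂ lam β γ),
      D.carrier = (Literature.MathematicalPhysics.KineticTheory.HeatConduction.pinnedChain ω₂ lam β γ).bmGood → (∀ t : ℝ, Measurable (D.flow t)) →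
      (∀ t : ℝ, ∀ σ ∉ (Literature.MathematicalPhysics.KineticTheory.HeatConduction.pinnedChain ω₂ lam β γ).bmGood, D.flow t σ = σ) →
      ∃ μ : MeasureTheory.Measure (ℤ → ℝ × ℝ),
      (Literature.MathematicalPhysics.KineticTheory.HeatConduction.pinnedChain ω₂ lam β γ).IsChainGibbsMeasure T μ ∧ Literature.MathematicalPhysics.KineticTheory.HeatConduction.IsShiftInvariant μ ∧
      (Literature.MathematicalPhysics.KineticTheory.HeatConduction.pinnedChain ω₂ lam β γ).HasSuperstabilityEstimate μ ∧
      μ.map (fun (σ : ℤ → ℝ × ℝ) (x : ℤ) => σ (-x)) = μ ∧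
      (∀ a ∈ ({fun σ => (Literature.MathematicalPhysics.KineticTheory.HeatConduction.pinnedChain ω₂ lam β γ).bondCurrentZ σ 0,
      fun σ => (Literature.MathematicalPhysics.KineticTheory.HeatConduction.pinnedChain ω₂ lam β γ).energyDensityZ σ 0} : Set ((ℤ → ℝ × ℝ) → ℝ)),
      ∀ b ∈ ({fun σ => (Literature.MathematicalPhysics.KineticTheory.HeatConduction.pinnedChain ω₂ lam β γ).bondCurrentZ σ 0,
      fun σ => (Literature.MathematicalPhysics.KineticTheory.HeatConduction.pinnedChain ω₂ lam β γ).energyDensityZ σ 0} : Set ((ℤ → ℝ × ℝ) → ℝ)),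
      ∀ u : ℝ, Summable fun x : ℤ =>
      ProbabilityTheory.covariance a ((b ∘ Literature.MathematicalPhysics.KineticTheory.HeatConduction.chainShift x) ∘ D.flow u) μ) ∧
      (∀ a ∈ ({fun σ => (Literature.MathematicalPhysics.KineticTheory.HeatConduction.pinnedChain ω₂ lam β γ).bondCurrentZ σ 0,
      fun σ => (Literature.MathematicalPhysics.KineticTheory.HeatConduction.pinnedChain ω₂ lam β γ).energyDensityZ σ 0} : Set ((ℤ → ℝ × ℝ) → ℝ)),
      ContinuousAt (fun t : ℝ => ∑' x : ℤ,
      ProbabilityTheory.covariance a ((a ∘ Literature.MathematicalPhysics.KineticTheory.HeatConduction.chainShift x) ∘ D.flow t) μ) 0)) :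
    ∀ ω₂ lam β γ : ℝ, 0 < ω₂ → 0 < lam → 0 < β → 0 < γ → ∀ T : ℝ, 0 < T →
      ∃ (D : Literature.MathematicalPhysics.KineticTheory.HeatConduction.InfiniteChainDynamics
            (Literature.MathematicalPhysics.KineticTheory.HeatConduction.pinnedChain ω₂ lam β γ))
        (Z : Literature.MathematicalPhysics.KineticTheory.HeatConduction.ZeroWavenumberData
            (Literature.MathematicalPhysics.KineticTheory.HeatConduction.pinnedChain ω₂ lam β γ) D),
        D.carrier =
          (Literature.MathematicalPhysics.KineticTheory.HeatConduction.pinnedChain ω₂ lam β γ).bmGood ∧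
        (Literature.MathematicalPhysics.KineticTheory.HeatConduction.pinnedChain
            ω₂ lam β γ).IsChainGibbsMeasure T Z.μ ∧
        (∀ ψ : Literature.MathematicalPhysics.KineticTheory.HeatConduction.ZeroWavenumberSpace Z,
          Continuous fun t : ℝ => Z.koopman t ψ) := by
  intro ω₂ lam β γ hω hl hβ hγ T hT
  obtain ⟨D, hD, hall⟩ :=
    Summit.AtomisticToContinuum.FouriersLaw.Theorems.MourreDissolution.symmetricFramework_of_clustering
      hH ω₂ lam β γ hω hl hβ hγ
  obtain ⟨Z, hG, -, -, -, -, -, hsc⟩ := hall T hT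
  exact ⟨D, Z, hD, hG, hsc⟩

/-- **`DrudeDissolution ⇐ (H) ∧ (K)`** (registered sub-goal of stmt-AtomisticToContinuum-12593; the
checked composition of line `Sketch`, rev 4, with its two open stubs as explicit hypotheses — (H) is
`stub_gibbsClustering` verbatim, (K) is `stub_kineticGreenKubo` verbatim): the Gibbs/clustering
infrastructure statement shared with stmt-12594 and finite positive Green–Kubo conductivity on a
low-temperature corner for every canonical zero-wavenumber datum together imply the dissolved Drude
atom (via rev 3's `drudeDissolution_of_framework_of_kineticGreenKubo`). [folklore] -/
theorem drudeDissolution_of_gibbsClustering_of_kineticGreenKubo :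
    (∀ ω₂ lam β γ : ℝ, 0 < ω₂ → 0 < lam → 0 < β → ∀ T : ℝ, 0 < T →
      ∀ D : Literature.MathematicalPhysics.KineticTheory.HeatConduction.InfiniteChainDynamics (Literature.MathematicalPhysics.KineticTheory.HeatConduction.pinnedChain ω₂ lam β γ),
      D.carrier = (Literature.MathematicalPhysics.KineticTheory.HeatConduction.pinnedChain ω₂ lam β γ).bmGood → (∀ t : ℝ, Measurable (D.flow t)) →
      (∀ t : ℝ, ∀ σ ∉ (Literature.MathematicalPhysics.KineticTheory.HeatConduction.pinnedChain ω₂ lam β γ).bmGood, D.flow t σ = σ) →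
      ∃ μ : MeasureTheory.Measure (ℤ → ℝ × ℝ),
      (Literature.MathematicalPhysics.KineticTheory.HeatConduction.pinnedChain ω₂ lam β γ).IsChainGibbsMeasure T μ ∧ Literature.MathematicalPhysics.KineticTheory.HeatConduction.IsShiftInvariant μ ∧
      (Literature.MathematicalPhysics.KineticTheory.HeatConduction.pinnedChain ω₂ lam β γ).HasSuperstabilityEstimate μ ∧
      μ.map (fun (σ : ℤ → ℝ × ℝ) (x : ℤ) => σ (-x)) = μ ∧
      (∀ a ∈ ({fun σ => (Literature.MathematicalPhysics.KineticTheory.HeatConduction.pinnedChain ω₂ lam β γ).bondCurrentZ σ 0,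
      fun σ => (Literature.MathematicalPhysics.KineticTheory.HeatConduction.pinnedChain ω₂ lam β γ).energyDensityZ σ 0} : Set ((ℤ → ℝ × ℝ) → ℝ)),
      ∀ b ∈ ({fun σ => (Literature.MathematicalPhysics.KineticTheory.HeatConduction.pinnedChain ω₂ lam β γ).bondCurrentZ σ 0,
      fun σ => (Literature.MathematicalPhysics.KineticTheory.HeatConduction.pinnedChain ω₂ lam β γ).energyDensityZ σ 0} : Set ((ℤ → ℝ × ℝ) → ℝ)),
      ∀ u : ℝ, Summable fun x : ℤ =>
      ProbabilityTheory.covariance a ((b ∘ Literature.MathematicalPhysics.KineticTheory.HeatConduction.chainShift x) ∘ D.flow u) μ) ∧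
      (∀ a ∈ ({fun σ => (Literature.MathematicalPhysics.KineticTheory.HeatConduction.pinnedChain ω₂ lam β γ).bondCurrentZ σ 0,
      fun σ => (Literature.MathematicalPhysics.KineticTheory.HeatConduction.pinnedChain ω₂ lam β γ).energyDensityZ σ 0} : Set ((ℤ → ℝ × ℝ) → ℝ)),
      ContinuousAt (fun t : ℝ => ∑' x : ℤ,
      ProbabilityTheory.covariance a ((a ∘ Literature.MathematicalPhysics.KineticTheory.HeatConduction.chainShift x) ∘ D.flow t) μ) 0)) →
    (∀ ω₂ lam β γ : ℝ, 0 < ω₂ → 0 < lam → 0 < β → 0 < γ → ∃ T₀ : ℝ, 0 < T₀ ∧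
      ∀ T : ℝ, 0 < T → T < T₀ →
        ∀ (D : Literature.MathematicalPhysics.KineticTheory.HeatConduction.InfiniteChainDynamics
              (Literature.MathematicalPhysics.KineticTheory.HeatConduction.pinnedChain ω₂ lam β γ))
          (Z : Literature.MathematicalPhysics.KineticTheory.HeatConduction.ZeroWavenumberData
              (Literature.MathematicalPhysics.KineticTheory.HeatConduction.pinnedChain ω₂ lam β γ) D),
          D.carrier =
            (Literature.MathematicalPhysics.KineticTheory.HeatConduction.pinnedChain ω₂ lam β γ).bmGood →
          (Literature.MathematicalPhysics.KineticTheory.HeatConduction.pinnedChain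
              ω₂ lam β γ).IsChainGibbsMeasure T Z.μ →
          MeasureTheory.IntegrableOn (D.currentCorrelation Z.μ) (Set.Ioi 0) ∧
            0 < ∫ t in Set.Ioi (0 : ℝ), D.currentCorrelation Z.μ t) →
    Summit.AtomisticToContinuum.FouriersLaw.Theses.EmbeddedDrudeMourre.DrudeDissolution :=
  fun hH hK => drudeDissolution_of_framework_of_kineticGreenKubo
    (zeroWavenumberFramework_of_gibbsClustering hH) hK

end Summit.AtomisticToContinuum.FouriersLaw.Theorems.DrudeDissolution.LineSketch

end
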